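import Summits.CriticalPhenomena.SAWScalingLimit.Theorems.SAWLoopFugacityFlowSimpleSubseqLimitsFirstHitFlat
import HarnessLib

/-!
# Rohde–Schramm one level down, GUARDED form: only returns to the FAR past must be excluded

Helper file for the crux `SimpleSubseqLimits` (stmt-CriticalPhenomena-4982; decl
`Summit.CriticalPhenomena.SAWScalingLimit.Theses.SAWLoopFugacityFlow.SimpleSubseqLimits`), line
lead c4 (2026-08-17), sharpening the landed closing lemma `FirstHitFlat` (lead c2, p129562).

`FirstHitFlat.isFlat_of_firstHit_closedBall` asks that after the FIRST hit `T` of each closed ball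
`B̄(q, r)` the curve never returns to ANY value `γ v`, `v < T`.  The descent actually uses far less:
in both applications of the loop lemma the earlier time `v` is one before which the WHOLE initial piece
`γ [0, v]` keeps a margin from the separating ball, and the ball may be shrunk at will inside that
margin.  So it suffices to exclude returns to values `γ v` such that `γ [0, v]` stays OUTSIDE the
concentric GUARD ball `B̄(q, 5r)` ("returns to the far past"): these are exactly the returns which, on
the lattice, are interactions between the PAST before the first entrance of the walk into `B̄(q, 5r)`
and the FUTURE after its first entrance into `B̄(q, r')`, `r < r' < 5r` — a one-stopping-time
past/future event for the exact domain Markov property (the slit-boundary avoidance of the conditioned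
walk), with no future/future near-return mixed in.  See
`Theorems/SAWLoopFugacityFlowSimpleSubseqLimitsFirstHitSlitPassage.lean` for the lattice typing this feeds.

Main results (namespace `…Theorems.SimpleSubseqLimits.FirstHitFlatGuard`):
* `image_subset_of_apply_eq` — guarded loop lemma for an indexed family of closed sets `C i` with guard
  sets `G i ⊇ C i`: if the future after the first hit of every `C i` avoids the values `γ v` whose
  initial piece `γ [0, v]` misses `G i`, then the loop of every coincidence stays in the past range;
* `isFlat_of_firstHit_avoids` — hence the curve is FLAT (same two-step descent as `FirstHitFlat`);
* `exists_closedBall_separating` — closed balls with centres in a dense set and rational radii separate a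
  value from a compact piece of the past WITH A GUARD FACTOR `5` (shrink the ball to a twentieth of the
  margin);
* `isFlat_of_firstHit_closedBall` / `mk_mem_simple_of_firstHit_closedBall` /
  `firstHit_closedBall_guard_simple` — the ball instance: after the first hit `T` of `B̄(q, r)` the curve
  never returns to a value `γ v`, `v < T`, with `5r < dist (γ w) q` for all `w ≤ v` ⇒ flat ⇒ (distinct
  endpoints) simple class;
* `of_unguarded` — no strength wasted: the unguarded hypothesis of `FirstHitFlat` implies the guarded one.
-/

noncomputable section

open Set Topology Metric
open scoped unitInterval

namespace Summit.CriticalPhenomena.SAWScalingLimit.Theorems.SimpleSubseqLimits.FirstHitFlatGuard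

open Literature.Probability.RandomPlanarGeometry
open Summit.CriticalPhenomena.SAWScalingLimit.Theorems.SimpleSubseqLimits.FirstHitFlat (exists_firstHit)

variable {E : Type*} {ι : Type*}

section Topological

variable [TopologicalSpace E]

/-- **Guarded loop lemma.** Let `C i` (`i : ι`) be closed sets with guards `G i ⊇ C i`, separating
values of the curve from compact pieces of its past with the guard missed (`hsep`), and suppose that
after the FIRST hit of every `C i` the curve never returns to a value `γ v` taken at a time `v` before
which the curve misses the guard `G i` (`havoid`). Then for every coincidence `γ p = γ q`, every value
`γ t₀`, `t₀ ≤ q`, was already taken on `[0, p]`. (Rohde–Schramm 2005, proof of Thm. 6.1, first step,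
with first hitting times of guarded closed sets for rational times.) [cite: RohdeSchramm2005, Thm. 6.1] -/
theorem image_subset_of_apply_eq (γ : Curve E) (C G : ι → Set E)
    (hclosed : ∀ i, IsClosed (C i)) (hCG : ∀ i, C i ⊆ G i)
    (hsep : ∀ s t : I, γ t ∉ γ '' Iic s → ∃ i, γ t ∈ C i ∧ ∀ v : I, v ≤ s → γ v ∉ G i)
    (havoid : ∀ i, ∀ t : I, γ t ∈ C i → (∀ v : I, v < t → γ v ∉ C i) →
      ∀ v u : I, v < t → t ≤ u → (∀ w : I, w ≤ v → γ w ∉ G i) → γ u ≠ γ v)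
    {p q : I} (heq : γ p = γ q) {t₀ : I} (htq : t₀ ≤ q) :
    γ t₀ ∈ γ '' Iic p := by
  by_contra hnot
  obtain ⟨i, ht₀C, hpast⟩ := hsep p t₀ hnot
  obtain ⟨t, htt₀, htC, hfirst⟩ := exists_firstHit γ (hclosed i) ht₀C
  have hpt' : p < t := lt_of_not_ge fun h => hpast t h (hCG i htC)
  exact havoid i t htC hfirst p q hpt' (htt₀.trans htq) hpast heq.symm

/-- **Guarded first-hit avoidance ⇒ flat.** Under the hypotheses of the guarded loop lemma (points
closed in `E`) the curve is flat: if `γ s = γ t` with `s ≤ u ≤ t` then `γ u = γ s`. Two-step descent on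
the first visit `s₁` of the value `γ s`, exactly as in `FirstHitFlat.isFlat_of_firstHit_avoids`; only
guarded returns are ever used. (Rohde–Schramm 2005, proof of Thm. 6.1.)
[cite: RohdeSchramm2005, Thm. 6.1] -/
theorem isFlat_of_firstHit_avoids [T1Space E] (γ : Curve E) (C G : ι → Set E)
    (hclosed : ∀ i, IsClosed (C i)) (hCG : ∀ i, C i ⊆ G i)
    (hsep : ∀ s t : I, γ t ∉ γ '' Iic s → ∃ i, γ t ∈ C i ∧ ∀ v : I, v ≤ s → γ v ∉ G i)
    (havoid : ∀ i, ∀ t : I, γ t ∈ C i → (∀ v : I, v < t → γ v ∉ C i) →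
      ∀ v u : I, v < t → t ≤ u → (∀ w : I, w ≤ v → γ w ∉ G i) → γ u ≠ γ v) :
    γ.IsFlat := by
  intro s u t hsu hut hst
  have hcl : IsClosed (γ ⁻¹' {γ s}) := isClosed_singleton.preimage γ.continuous
  obtain ⟨s₁, hs₁x, hleast⟩ := hcl.isCompact.exists_isLeast ⟨s, rfl⟩
  have hs₁x' : γ s₁ = γ s := hs₁x
  by_contra hne
  obtain ⟨v, hv, hvu⟩ :=
    image_subset_of_apply_eq γ C G hclosed hCG hsep havoid (hs₁x'.trans hst) hut
  have hvs₁ : v < s₁ := by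
    refine lt_of_le_of_ne hv fun h => hne ?_
    rw [← hvu, h, hs₁x']
  obtain ⟨w, hw, hws⟩ := image_subset_of_apply_eq γ C G hclosed hCG hsep havoid hvu hsu
  have hs₁w : s₁ ≤ w := hleast (show γ w ∈ ({γ s} : Set E) from hws)
  exact absurd (hs₁w.trans hw) (not_le.2 hvs₁)

end Topological

section Metric

variable [MetricSpace E]

/-- **Guarded separation by closed balls.** A value `γ t` not taken on `[0, s]` lies in a closed ball
`B̄(q, r)`, `q` in a given dense set, `r` positive rational, whose concentric guard ball of radius `5r`
is missed by `γ [0, s]` (indeed `5r < dist (γ v) q` for `v ≤ s`): take the margin `ε` of `γ t` from the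
compact past, a centre within `ε/20` and a radius in `(ε/20, ε/10)`. [folklore] -/
theorem exists_closedBall_separating (γ : Curve E) {S : Set E} (hS : Dense S) (s t : I)
    (ht : γ t ∉ γ '' Iic s) :
    ∃ q ∈ S, ∃ r : ℚ, 0 < r ∧ γ t ∈ closedBall q (r : ℝ) ∧
      ∀ v : I, v ≤ s → 5 * (r : ℝ) < dist (γ v) q := by
  have hK : IsCompact (γ '' Iic s) := isClosed_Iic.isCompact.image γ.continuous
  obtain ⟨ε, hε, hball⟩ := Metric.isOpen_iff.1 hK.isClosed.isOpen_compl (γ t) ht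
  obtain ⟨q, hqS, hq⟩ := hS.exists_dist_lt (γ t) (by positivity : (0 : ℝ) < ε / 20)
  obtain ⟨r, hr₁, hr₂⟩ := exists_rat_btwn (by linarith : ε / 20 < ε / 10)
  have hr0 : (0 : ℝ) < r := by linarith
  refine ⟨q, hqS, r, by exact_mod_cast hr0, ?_, fun v hv => ?_⟩
  · rw [mem_closedBall]; linarith
  · have hvt : ε ≤ dist (γ v) (γ t) := by
      by_contra hlt
      exact hball (mem_ball.2 (not_le.1 hlt)) ⟨v, hv, rfl⟩
    have htri := dist_triangle (γ v) q (γ t)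
    rw [dist_comm] at hq
    linarith

/-- **Guarded first-hit avoidance over closed balls ⇒ flat.** If after its FIRST entrance `T` into each
closed ball `B̄(q, r)` (`q` in a dense set `S`, `r` positive rational) the curve never returns to a value
`γ v`, `v < T`, whose initial piece keeps out of the guard ball (`5r < dist (γ w) q` for all `w ≤ v`),
then the curve is flat. (Rohde–Schramm 2005, proof of Thm. 6.1, guarded, first hitting times of balls for
rational times.) [cite: RohdeSchramm2005, Thm. 6.1] -/
theorem isFlat_of_firstHit_closedBall (γ : Curve E) {S : Set E} (hS : Dense S)
    (havoid : ∀ q ∈ S, ∀ r : ℚ, 0 < r → ∀ t : I, γ t ∈ closedBall q (r : ℝ) →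
      (∀ v : I, v < t → γ v ∉ closedBall q (r : ℝ)) → ∀ v u : I, v < t → t ≤ u →
      (∀ w : I, w ≤ v → 5 * (r : ℝ) < dist (γ w) q) → γ u ≠ γ v) :
    γ.IsFlat := by
  let ι := {p : E × ℚ // p.1 ∈ S ∧ 0 < p.2}
  refine isFlat_of_firstHit_avoids γ (fun i : ι => closedBall i.1.1 (i.1.2 : ℝ))
    (fun i : ι => closedBall i.1.1 (5 * (i.1.2 : ℝ))) (fun _ => isClosed_closedBall) ?_ ?_ ?_
  · rintro ⟨⟨q, r⟩, -, hr⟩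
    have hr' : (0 : ℝ) ≤ r := by exact_mod_cast hr.le
    exact closedBall_subset_closedBall (by linarith)
  · intro s t ht
    obtain ⟨q, hqS, r, hr, htB, hpast⟩ := exists_closedBall_separating γ hS s t ht
    refine ⟨⟨(q, r), hqS, hr⟩, htB, fun v hv hvG => ?_⟩
    have h := hpast v hv
    rw [mem_closedBall] at hvG
    exact absurd hvG (not_le.2 h)
  · rintro ⟨⟨q, r⟩, hqS, hr⟩ t htC hfirst v u hvt htu hguard
    refine havoid q hqS r hr t htC hfirst v u hvt htu fun w hw => ?_
    have h := hguard w hw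
    rw [mem_closedBall, not_le] at h
    exact h

/-- **Guarded first-hit avoidance over closed balls ⇒ simple class** (distinct endpoints;
monotone–light factorisation of flat curves, `Curve.exists_isSimple_of_isFlat`).
(Rohde–Schramm 2005, Thm. 6.1, on the quotient `CurveClass`.) [cite: RohdeSchramm2005, Thm. 6.1] -/
theorem mk_mem_simple_of_firstHit_closedBall (γ : Curve E) {S : Set E} (hS : Dense S)
    (havoid : ∀ q ∈ S, ∀ r : ℚ, 0 < r → ∀ t : I, γ t ∈ closedBall q (r : ℝ) →
      (∀ v : I, v < t → γ v ∉ closedBall q (r : ℝ)) → ∀ v u : I, v < t → t ≤ u →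
      (∀ w : I, w ≤ v → 5 * (r : ℝ) < dist (γ w) q) → γ u ≠ γ v)
    (h01 : γ 0 ≠ γ 1) : CurveClass.mk γ ∈ CurveClass.simple := by
  obtain ⟨γ₀, hγ₀, -, hd⟩ :=
    Curve.exists_isSimple_of_isFlat (isFlat_of_firstHit_closedBall γ hS havoid) h01
  refine ⟨γ₀, hγ₀, ?_⟩
  rw [CurveClass.mk_eq_mk_iff_dist_eq_zero, dist_comm]
  exact hd

/-- **No strength wasted**: the unguarded hypothesis of `FirstHitFlat` (no return to ANY earlier value
after a first hit) implies the guarded one. [folklore] -/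
theorem of_unguarded (γ : Curve E) {S : Set E}
    (havoid : ∀ q ∈ S, ∀ r : ℚ, 0 < r → ∀ t : I, γ t ∈ closedBall q (r : ℝ) →
      (∀ v : I, v < t → γ v ∉ closedBall q (r : ℝ)) → ∀ v u : I, v < t → t ≤ u → γ u ≠ γ v) :
    ∀ q ∈ S, ∀ r : ℚ, 0 < r → ∀ t : I, γ t ∈ closedBall q (r : ℝ) →
      (∀ v : I, v < t → γ v ∉ closedBall q (r : ℝ)) → ∀ v u : I, v < t → t ≤ u →
      (∀ w : I, w ≤ v → 5 * (r : ℝ) < dist (γ w) q) → γ u ≠ γ v :=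
  fun q hq r hr t ht hfirst v u hvt htu _ => havoid q hq r hr t ht hfirst v u hvt htu

end Metric

/-- **Planar form for the crux item stmt-CriticalPhenomena-4982**: a planar curve with distinct
endpoints whose future after its first entrance into each closed ball `B̄(q, r)` (`q` in a dense set,
`r` positive rational) never returns to a value `γ v`, `v` earlier, taken while the curve had not yet met
the guard ball `B̄(q, 5r)`, has a SIMPLE class. (Rohde–Schramm 2005, Thm. 6.1, guarded, one level down,
on `CurveClass ℂ`.) [cite: RohdeSchramm2005, Thm. 6.1] -/
theorem firstHit_closedBall_guard_simple : ∀ (γ : Curve ℂ) (S : Set ℂ), Dense S → (∀ q ∈ S, ∀ r : ℚ, 0 < r → ∀ t : I, γ t ∈ closedBall q (r : ℝ) → (∀ v : I, v < t → γ v ∉ closedBall q (r : ℝ)) → ∀ v u : I, v < t → t ≤ u → (∀ w : I, w ≤ v → 5 * (r : ℝ) < dist (γ w) q) → γ u ≠ γ v) → γ 0 ≠ γ 1 → CurveClass.mk γ ∈ CurveClass.simple :=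
  fun γ _S hS havoid h01 => mk_mem_simple_of_firstHit_closedBall γ hS havoid h01

end Summit.CriticalPhenomena.SAWScalingLimit.Theorems.SimpleSubseqLimits.FirstHitFlatGuard

end
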